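import Mathlib.Geometry.Manifold.VectorBundle.Hom
import Mathlib.Geometry.Manifold.VectorBundle.Tangent
import Mathlib.Geometry.Manifold.MFDeriv.Tangent
import Mathlib.Geometry.Manifold.Instances.Real
import Mathlib.Analysis.InnerProductSpace.PiL2

/-!
# The coordinate expression of a smooth endomorphism field is smooth on the whole chart

Crux `WitnessCharge` (item stmt-SmoothPoincare4-7824, route route-SmoothPoincare4-SullivanDual),
line `Sketch`, stub `helper_inTangentCoordinates_contMDiffOn`.

The crux states smoothness of an almost complex structure `J` (a family of endomorphisms of the
tangent spaces of a `4`-manifold `M`) as: for every `x₀`, the `x₀`-frame expression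
`x ↦ inTangentCoordinates I I id id (fun x => J x) x₀ x` is `C^∞` *at* `x₀`. The chart
localisation steps of the frontier dichotomy (P5) need that expression to be `C^∞` on the *whole*
chart domain of `x₀`. This is a formal consequence of Mathlib's vector-bundle section API:

* `J` is a section of the hom bundle `fun x ↦ TangentSpace I x →L[ℝ] TangentSpace I x`
  (a `C^∞` vector bundle, `ContMDiffVectorBundle.continuousLinearMap`), and by
  `contMDiffAt_hom_bundle` the hypothesis says exactly that this section is `C^∞` at every point
  (the trivialization of the hom bundle at `x₀` reads a fibre element in coordinates through
  `ContinuousLinearMap.inCoordinates`, which is `inTangentCoordinates` by definition);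
* a `C^∞` section read in the fixed trivialization `e` at `x₀` is `C^∞` on the whole base set of
  `e` (`Trivialization.contMDiffOn_section_baseSet_iff`), and that base set is the chart domain
  of `x₀` (`hom_trivializationAt_baseSet`, `TangentBundle.trivializationAt_baseSet`).
-/

noncomputable section

set_option linter.dupNamespace false

open scoped Manifold ContDiff Topology Bundle
open Set Filter

namespace Summit.SmoothPoincare4.SmoothPoincare4.Theorems.WitnessCharge.PencilIncompleteness

/-- **The coordinate expression of a smooth endomorphism field is smooth on the whole chart.**
If, for every `x₀ : M`, the expression `x ↦ inTangentCoordinates (𝓡 4) (𝓡 4) id id J x₀ x` of a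
field of endomorphisms `J x : T_x M →L[ℝ] T_x M` in the trivialization of the tangent bundle at
`x₀` is `C^∞` at `x₀`, then for every `x₀` it is `C^∞` on the whole chart domain
`(chartAt _ x₀).source`. Proof: `J` is then a `C^∞` section of the hom bundle
`Hom(TM, TM)` (`contMDiffAt_hom_bundle`), and a `C^∞` section read in the trivialization at `x₀`
is `C^∞` on its base set (`Trivialization.contMDiffOn_section_baseSet_iff`), which is the chart
domain of `x₀`. -/
theorem helper_inTangentCoordinates_contMDiffOn :
    ∀ (M : Type) [TopologicalSpace M] [ChartedSpace (EuclideanSpace ℝ (Fin 4)) M]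
      [IsManifold (𝓡 4) ∞ M]
      (J : ∀ x : M, TangentSpace (𝓡 4) x →L[ℝ] TangentSpace (𝓡 4) x),
      (∀ x₀ : M, ContMDiffAt (𝓡 4) 𝓘(ℝ, EuclideanSpace ℝ (Fin 4) →L[ℝ] EuclideanSpace ℝ (Fin 4)) ∞
        (inTangentCoordinates (𝓡 4) (𝓡 4) (id : M → M) id (fun x => J x) x₀) x₀) →
      ∀ x₀ : M, ContMDiffOn (𝓡 4) 𝓘(ℝ, EuclideanSpace ℝ (Fin 4) →L[ℝ] EuclideanSpace ℝ (Fin 4)) ∞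
        (inTangentCoordinates (𝓡 4) (𝓡 4) (id : M → M) id (fun x => J x) x₀)
        (chartAt (EuclideanSpace ℝ (Fin 4)) x₀).source := by
  intro M _ _ _ J hJ x₀
  -- `J` as a section of the hom bundle `Hom(TM, TM)` is `C^∞` everywhere
  have hsec : ContMDiff (𝓡 4)
      ((𝓡 4).prod 𝓘(ℝ, EuclideanSpace ℝ (Fin 4) →L[ℝ] EuclideanSpace ℝ (Fin 4))) ∞
      (fun x : M ↦ Bundle.TotalSpace.mk' (EuclideanSpace ℝ (Fin 4) →L[ℝ] EuclideanSpace ℝ (Fin 4))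
        (E := fun x : M ↦ TangentSpace (𝓡 4) x →L[ℝ] TangentSpace (𝓡 4) x) x (J x)) := by
    intro x
    rw [contMDiffAt_hom_bundle]
    exact ⟨contMDiffAt_id, hJ x⟩
  -- the trivialization of the hom bundle at `x₀`; its base set is the chart domain of `x₀`
  set e := trivializationAt (EuclideanSpace ℝ (Fin 4) →L[ℝ] EuclideanSpace ℝ (Fin 4))
    (fun x : M ↦ TangentSpace (𝓡 4) x →L[ℝ] TangentSpace (𝓡 4) x) x₀ with he
  have h1 : ContMDiffOn (𝓡 4) 𝓘(ℝ, EuclideanSpace ℝ (Fin 4) →L[ℝ] EuclideanSpace ℝ (Fin 4)) ∞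
      (fun x ↦ (e ⟨x, J x⟩).2) e.baseSet :=
    (e.contMDiffOn_section_baseSet_iff).1 hsec.contMDiffOn
  have hbase : e.baseSet = (chartAt (EuclideanSpace ℝ (Fin 4)) x₀).source := by
    rw [he, hom_trivializationAt_baseSet, TangentBundle.trivializationAt_baseSet, inter_self]
  rw [← hbase]
  refine h1.congr fun x _ ↦ ?_
  rw [he, hom_trivializationAt_apply]
  rfl

end Summit.SmoothPoincare4.SmoothPoincare4.Theorems.WitnessCharge.PencilIncompleteness
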